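import Mathlib.NumberTheory.Padics.ProperSpace
import Literature.IUT.LogThetaLattice.PacketLogVolumesLogLink
import HarnessLib

/-!
# [IUTchIII] Prop. 3.9 (iv)(b) at a nonarchimedean place — NON-VACUITY of the admissible class and the
# instance at the model of record `ℚ_p` (proof-only companion of `PacketLogVolumesLogLink.lean`; abc-iut
# cell, layer L6, L-F register row LF6-20 / FACT-LIST F-2117)

S. Mochizuki, *Inter-universal Teichmüller theory III*, kurims manuscript (May 2020), §3, Prop. 3.9 (iv)(b)
p. 117 [claim: Mochizuki2012, status: disputed]: "the log-volumes … indexed by `(n, m)` are compatible … with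
the corresponding log-volumes indexed by `(n, m−1)`, relative to the log-link"; Remark 3.9.4 (iii) p. 122 /
[AbsTopIII] Prop. 5.7 (i)(c): "for any compact … `S ⊆ 𝒪^×_k` on which `log_k` is injective, we have
`μ_k(S) = μ_k(log_k(S))`"; Remark 3.9.6 p. 145 ("sufficiently small" regions).

abc-iut-L6-t4 typed (iv)(b) as the predicate `Prop39iv_b X vol lg Adm` (`PacketLogVolumes.lean`, p404053) and
`PacketLogVolumesLogLink.lean` (p410652) DISCHARGED it at one nonarchimedean place over the genuine `p`-adic
logarithm: `prop39iv_b_unitLog` / `prop39iv_b_unitLog_measure`, for EVERY mixed-characteristic local datum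
`K` (`[NormedAlgebra ℚ_[p] K] [IsUltrametricDist K] [ProperSpace K]`), every additive Haar measure `μ`, with
`Adm :=` the compact subsets of `𝒪^×_K` on which `log_p` is injective. THIS FILE adds, with no new
definitions:

* **`closedBall_one_mem_adm`** — the admissible class is NOT EMPTY in a load-bearing way: at every `K` as
  above the ball `1 + p²𝒪`-style region `closedBall 1 p⁻²` consists of units, is compact, and `log_p` is
  injective on it (abc-iut-L6-d5's `unitLog_injOn_closedBall_unit`), and **`measure_closedBall_one_pos`** —
  it has POSITIVE Haar measure; hence **`prop39iv_b_unitLog_nonvacuous`**: at every lattice position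
  `(n, m)` the compatibility equation of `prop39iv_b_unitLog` binds a region of positive measure, and
  **`measure_image_unitLog_closedBall_one`** computes both sides (`μ(log_p(B)) = μ(B)`), the nonarchimedean
  twin of abc-iut-w4-d001's `angularLogVolume_arc` (`PacketLogVolumesLogLinkArch.lean`, p411790);
* **`prop39iv_b_unitLog_padic`** — the instance at the MODEL OF RECORD `K := ℚ_p` itself (Mathlib's
  `ProperSpace ℚ_[p]`, `IsUltrametricDist ℚ_[p]`, `NormedAlgebra.id`), and
  **`prop39iv_b_unitLog_padic_inhabited`** — a CLOSED witness whose only binders are `p` and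
  `[Fact p.Prime]`: a Borel structure and an additive Haar measure on `ℚ_p` exist for which `Prop39iv_b`
  holds and every `Adm n m` contains a region of positive measure (the binder family of
  `prop39iv_b_unitLog` is inhabited).

Classical `p`-adic measure theory; nothing here bears on the disputed [IUTchIII] Cor. 3.12 or takes a
side; an instance-form theorem at our model is not the print universal closure; typed ≠ proved elsewhere.
-/

set_option autoImplicit false

noncomputable section

open MeasureTheory MeasureTheory.Measure Set Metric
open scoped ENNReal

namespace Literature.IUT.LogThetaLattice

open Literature.IUT.LogVolume

universe u

/-! ### Non-vacuity of the admissible class at every `K` -/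

section Units

variable (p : ℕ) [Fact p.Prime]
variable (K : Type u) [NontriviallyNormedField K] [IsUltrametricDist K]

/-- The closed ball of radius `p⁻²` centred at `1` consists of units (`p⁻² < 1` and the norm is
ultrametric). [claim: Mochizuki2012, status: disputed] -/
theorem closedBall_one_subset_units :
    closedBall (1 : K) ((p : ℝ) ^ (-(2 : ℝ))) ⊆ {x : K | ‖x‖ = 1} := fun _ hy =>
  norm_eq_one_of_mem_closedBall_unit norm_one (rpow_neg_two_lt_one p) hy

end Units

section General

variable (p : ℕ) [Fact p.Prime]
variable (K : Type u) [NontriviallyNormedField K] [instK : NormedAlgebra ℚ_[p] K] [IsUltrametricDist K]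
  [ProperSpace K]

include instK

/-- **The admissible class of `prop39iv_b_unitLog` is inhabited by a genuine region**: the closed ball
`closedBall 1 p⁻²` is a compact set of units on which `log_p` is injective ([IUTchIII] Rmk. 3.9.4 (iii);
abc-iut-L6-d5's `unitLog_injOn_closedBall_unit`). [claim: Mochizuki2012, status: disputed] -/
theorem closedBall_one_mem_adm :
    closedBall (1 : K) ((p : ℝ) ^ (-(2 : ℝ))) ∈
      {S : Set K | S ⊆ {x : K | ‖x‖ = 1} ∧ IsCompact S ∧ Set.InjOn (unitLog (K := K)) S} :=
  ⟨closedBall_one_subset_units p K, isCompact_closedBall _ _,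
    unitLog_injOn_closedBall_unit p K norm_one⟩

variable [MeasurableSpace K] [BorelSpace K]

omit instK [IsUltrametricDist K] [ProperSpace K] [BorelSpace K] in
/-- The admissible region `closedBall 1 p⁻²` has POSITIVE measure for every additive Haar measure (a closed
ball of positive radius; Haar measures charge open sets). [claim: Mochizuki2012, status: disputed] -/
theorem measure_closedBall_one_pos (μ : Measure K) [μ.IsAddHaarMeasure] :
    0 < μ (closedBall (1 : K) ((p : ℝ) ^ (-(2 : ℝ)))) :=
  measure_closedBall_pos μ _ (rpow_neg_two_pos p)

/-- **Both sides of the compatibility, at the admissible region `B = closedBall 1 p⁻²`**: `μ(log_p(B)) = μ(B)`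
— the `(n, m)`-side volume of the image under the log-link equals the `(n, m−1)`-side volume; an
APPLICATION of abc-iut-L6-t4's instance `prop39iv_b_unitLog_measure` at the lattice position `(0, 0)` (the
nonarchimedean twin of `angularLogVolume_arc`). [claim: Mochizuki2012, status: disputed] -/
theorem measure_image_unitLog_closedBall_one (μ : Measure K) [μ.IsAddHaarMeasure] :
    μ (unitLog '' closedBall (1 : K) ((p : ℝ) ^ (-(2 : ℝ)))) =
      μ (closedBall (1 : K) ((p : ℝ) ^ (-(2 : ℝ)))) := by
  classical
  have h := prop39iv_b_unitLog_measure p K μ 0 0 _ (closedBall_one_mem_adm p K)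
  dsimp only at h
  rw [lgImage_eq_image_unitLog K (closedBall_one_subset_units p K)] at h
  have h1 : μ (unitLog '' closedBall (1 : K) ((p : ℝ) ^ (-(2 : ℝ)))) ≠ ∞ :=
    ((isCompact_closedBall _ _).image_of_continuousOn
      ((continuousOn_unitLog p K).mono (closedBall_one_subset_units p K))).measure_lt_top.ne
  have h2 : μ (closedBall (1 : K) ((p : ℝ) ^ (-(2 : ℝ)))) ≠ ∞ :=
    (isCompact_closedBall _ _).measure_lt_top.ne
  exact (ENNReal.toReal_eq_toReal_iff' h1 h2).mp h

open Classical in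
/-- **NON-VACUITY of [IUTchIII] Prop. 3.9 (iv)(b) at a nonarchimedean place** (the instance
`prop39iv_b_unitLog`): at every lattice position `(n, m)` the admissible class contains a region of
POSITIVE Haar measure — so the compatibility "log-volume at `(n, m)` of the log-link image = log-volume at
`(n, m−1)`" is asserted of non-null regions, not vacuously. [claim: Mochizuki2012, status: disputed] -/
theorem prop39iv_b_unitLog_nonvacuous (μ : Measure K) [μ.IsAddHaarMeasure] (n m : ℤ) :
    ∃ S ∈ (fun (_ _ : ℤ) => {S : Set K | S ⊆ {x : K | ‖x‖ = 1} ∧ IsCompact S ∧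
        Set.InjOn (unitLog (K := K)) S}) n m,
      0 < μ S ∧ Real.log (μ {y : K | ∃ x ∈ S, (if ‖x‖ = 1 then some (unitLog x) else none) = some y}).toReal
        = Real.log (μ S).toReal :=
  ⟨_, closedBall_one_mem_adm p K, measure_closedBall_one_pos p K μ,
    prop39iv_b_unitLog p K μ n m _ (closedBall_one_mem_adm p K)⟩

end General

/-! ### The model of record `K := ℚ_p` -/

section Padic

variable (p : ℕ) [Fact p.Prime]

open Classical in
/-- **IUTchIII:Prop3.9(iv)(b) at the MODEL OF RECORD `k = ℚ_p`** (kurims p. 117): for any Borel structure and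
any additive Haar measure `μ` on `ℚ_p`, abc-iut-L6-t4's `Prop39iv_b` HOLDS for `X n m := ℚ_p`, the
log-volume `log μ(·)`, the log-link := the genuine `p`-adic logarithm on `ℤ_p^×` (undefined elsewhere) and
the admissible class := compact subsets of `ℤ_p^×` on which `log_p` is injective — the instance
`prop39iv_b_unitLog` at `K := ℚ_[p]` (Mathlib: `ProperSpace ℚ_[p]`, `IsUltrametricDist ℚ_[p]`).
[claim: Mochizuki2012, status: disputed] -/
theorem prop39iv_b_unitLog_padic [MeasurableSpace ℚ_[p]] [BorelSpace ℚ_[p]] (μ : Measure ℚ_[p])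
    [μ.IsAddHaarMeasure] :
    Prop39iv_b (fun _ _ : ℤ => ℚ_[p]) (fun _ _ S => Real.log (μ S).toReal)
      (fun _ _ x => if ‖x‖ = 1 then some (unitLog x) else none)
      (fun _ _ => {S | S ⊆ {x : ℚ_[p] | ‖x‖ = 1} ∧ IsCompact S ∧
        Set.InjOn (unitLog (K := ℚ_[p])) S}) :=
  prop39iv_b_unitLog p ℚ_[p] μ

open Classical in
/-- **The binder family of `prop39iv_b_unitLog` is INHABITED at the model of record** (closed witness; only
`p` is quantified): on `ℚ_p` there are a Borel measurable structure and an additive Haar measure `μ` for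
which [IUTchIII] Prop. 3.9 (iv)(b) holds in abc-iut-L6-t4's typing AND every admissible class `Adm n m`
contains a region of positive `μ`-measure (`closedBall 1 p⁻² ⊆ ℤ_p^×`). [claim: Mochizuki2012, status: disputed] -/
theorem prop39iv_b_unitLog_padic_inhabited :
    ∃ (_ : MeasurableSpace ℚ_[p]) (μ : Measure ℚ_[p]), BorelSpace ℚ_[p] ∧ μ.IsAddHaarMeasure ∧
      Prop39iv_b (fun _ _ : ℤ => ℚ_[p]) (fun _ _ S => Real.log (μ S).toReal)
        (fun _ _ x => if ‖x‖ = 1 then some (unitLog x) else none)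
        (fun _ _ => {S | S ⊆ {x : ℚ_[p] | ‖x‖ = 1} ∧ IsCompact S ∧
          Set.InjOn (unitLog (K := ℚ_[p])) S}) ∧
      ∀ n m : ℤ, ∃ S ∈ (fun (_ _ : ℤ) => {S : Set ℚ_[p] | S ⊆ {x : ℚ_[p] | ‖x‖ = 1} ∧ IsCompact S ∧
          Set.InjOn (unitLog (K := ℚ_[p])) S}) n m, 0 < μ S := by
  letI : MeasurableSpace ℚ_[p] := borel _
  haveI : BorelSpace ℚ_[p] := ⟨rfl⟩
  exact ⟨inferInstance, Measure.addHaar, inferInstance, inferInstance, prop39iv_b_unitLog p ℚ_[p] _,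
    fun _ _ => ⟨_, closedBall_one_mem_adm p ℚ_[p], measure_closedBall_one_pos p ℚ_[p] _⟩⟩

end Padic

end Literature.IUT.LogThetaLattice

end
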